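import Literature.NumberTheory.EllipticCurves.Rank1Residual.Predicates
import Literature.NumberTheory.EllipticCurves.SerreOpenImageOrdinaryInertiaProofs
import Literature.NumberTheory.EllipticCurves.SerreOpenImageOfLocalInputProofs
import Literature.NumberTheory.EllipticCurves.SerreOpenImageNormalizerCaseProofs
import Literature.NumberTheory.GaloisRepresentations.SerreProp14GL2Fp
import Literature.NumberTheory.GaloisRepresentations.SerreCartanSubgroupsGL2FpProofs
import Literature.NumberTheory.EllipticCurves.BalakrishnanEtAl2019.SplitCartanImages
import HarnessLib

/-!
# BSD rank-≤1 residual cell — class X9: the SHAPE of the image at a good ordinary prime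
# (no non-split Cartan normaliser; for `p ≥ 7` a split Cartan normaliser of index `2`)

HONEST FRAMING (cell `b2b-bsdres-*`, verbatim): the goal of the cell is to DELETE the
COMBINATION-SHAPED residual classes for ALL analytic-rank ≤ 1 curves over ℚ — "full BSD formula
for every rank ≤ 1 curve in class C" assembled STRICTLY from published theorems — so that the
rank-≤1 remainder becomes exactly the CONSTRUCTION-SHAPED classes, which are TYPED (missing-input
Props), NOT attempted; this is not "finishing BSD".

Theorems only (no definitions, no named facts), over the cell's predicates
(`Rank1Residual/Predicates.lean`: `GoodOrd`, `Irr`, `Surj`, `ClassX9`) and the tree's Serre-1972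
vocabulary (`GaloisRepresentations/SerreCartanSubgroupsGL2Fp`: `halfSplitCartan`, `splitCartan`,
`unitGroup`, `cartanSubgroups`; frames `(e, Φ)` of `E[p]` as in
`SerreOpenImageNormalizerCaseProofs`, `G_p = Φ(ρ̄_{E,p}(Γ_ℚ))`).  Sequel to `X9SmallImage.lean`
(gen 1: (im) is false on X9) and `X9NoEntry.lean` (gen 2: ¬ram, ¬sst).  Class X9 is "`E[p]`
irreducible, `ρ̄_{E,p}` not onto, at a prime `p ≥ 5` of GOOD ORDINARY reduction"; the published
and announced discussion of such primes (Burungale–Castella–Skinner 2025, Rem. 1.1.3 (iii) /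
1.2.3: "(residually) dihedral primes … [BS24]") does not use the reduction type at `p`.  This file
records what good ORDINARY reduction at `p` forces on the image, by kernel theorems assembled from
the tree's proof of Serre's open image theorem:

* `exists_halfSplitCartan_le_image_of_goodOrd` — **at a good ordinary `p` the image contains a
  split half-Cartan subgroup** `P (1 0; 0 *) P⁻¹` (order `p - 1`): Serre 1972, §1.11, Prop. 11
  and Cor. — the inertia group at `p` acts on `E[p]` through `(χ *; 0 1)` with `χ` onto `𝔽_pˣ`
  (tree: `exists_line_of_not_dvd_frobeniusTrace_of_mem_primesAbove`,
  `exists_mem_inertia_smul_eq_of_sub_mem_line`, `Serre1972.exists_halfSplitCartan_le_map`).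
* `unitGroup_ne_splitCartan` — a non-split Cartan subgroup `kˣ` is not a split one (`p ≠ 2`).
* `not_le_normalizer_unitGroup_of_goodOrd` — **for `p ≥ 5` good ordinary, `G_p` is NOT contained
  in the normaliser of any non-split Cartan subgroup**: a split half-Cartan subgroup inside `N(C)`
  forces `C` to be ITS split Cartan subgroup (Serre §2.2, Prop. 14; tree
  `Serre1972.eq_splitCartan_of_halfSplitCartan_le_normalizer`).  No irreducibility or surjectivity
  hypothesis: this is a statement about every elliptic curve over `ℚ` at a good ordinary `p ≥ 5`.
* `exists_splitCartan_normalizer_of_goodOrd` — **for `p ≥ 7` good ordinary with `E[p]`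
  irreducible and `ρ̄_{E,p}` not onto, `G_p` normalises the SPLIT Cartan subgroup `C = P (* 0; 0 *) P⁻¹`
  of the inertia half-Cartan, and `G_p ⊄ C`** (Serre §2.7 Prop. 17 with `p ≠ 5`, §4.2 b); tree
  `exists_cartan_normalizer_of_not_hasSurjectiveModNGaloisRep`, then Prop. 14 again).  So the
  projective image is dihedral and `ρ̄_{E,p}` is induced from a character of the quadratic field
  `M` cut out by `U = ρ̄⁻¹(C)`; `exists_index_two_subgroup_of_goodOrd` records `[Γ_ℚ : U] = 2`,
  `U` open, and `U ⊇` every inertia group above `p` (Prop. 14: `M` is unramified at `p`) and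
  above every good prime `q ≠ p`.
* Class forms: `ClassX9.not_le_normalizer_unitGroup` (all of X9), `ClassX9.exists_splitCartan_normalizer`
  and `ClassX9.exists_index_two_subgroup` (X9 at `p ≥ 7`).

Consequences for the cell (prose; the deep inputs named here are NOT used in this file).  In
Sutherland's labels, X9 pairs have mod-`p` image of type `pNs` (a subgroup of the normaliser of a
split Cartan, not in the Cartan) or — only at `p = 5`, where Prop. 17 allows it — of exceptional
type `5S4`; the types `pNn` (non-split Cartan normaliser) NEVER meet X9, at any `p`, because they
force non-ordinary (supersingular or bad) reduction at `p`.  With the PUBLISHED classification of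
split-Cartan images — Bilu–Parent–Rebolledo, Ann. Inst. Fourier 63 (2013): no non-CM `E/ℚ` has
image in the normaliser of a split Cartan subgroup for `p ≥ 11`, `p ≠ 13`;
Balakrishnan–Dogra–Müller–Tuitman–Vonk, Ann. of Math. 189 (2019): the same at `p = 13` — X9 is
supported at `p ∈ {5, 7}` only (not vendored here; see the cell file
`b2b-bsdres-x9/X9-IMAGE-SHAPE-G3.md`).  The announced treatment of "dihedral primes" [BS24] is
relevant to X9 only in its SPLIT-dihedral case with `p` unramified in `M`.

Appended once the classification input landed as the named fact
`BalakrishnanEtAl2019.thm12_not_le_normalizer_splitCartan` (Ann. of Math. 189 (2019) Thm. 1.2, with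
Bilu–Parent–Rebolledo 2013 Cor. 1.2 inside; PUBLISHED): `ClassX9.eq_five_or_eq_seven` — **X9 is
supported at `p ∈ {5, 7}`** (conditional on that one fact, binder `hBDMTV`) — and the dichotomy
`ClassX9.exists_splitCartan_normalizer_or_eq_five`.

## References

* [Serre1972] J.-P. Serre, Invent. Math. 15 (1972): §1.11 Prop. 11 and Cor.; §2.2 Prop. 14;
  §2.7 Prop. 17; §4.2 b), Lemme 2.
* [BurungaleCastellaSkinner2025] A. Burungale, F. Castella, C. Skinner, IMRN 2025, rnaf082 =
  arXiv:2405.00270v2: Rem. 1.1.3 (iii), Rem. 1.2.3 (the "dihedral primes" left to [BS24]).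
-/

noncomputable section

open scoped Classical NumberField MatrixGroups
open IsDedekindDomain Field Matrix
open WeierstrassCurve NumberField
open Literature.NumberTheory.GaloisRepresentations
  Literature.NumberTheory.GaloisRepresentations.Serre1972

namespace Literature.NumberTheory.EllipticCurves.Rank1Residual

/-! ### Group theory: a non-split Cartan subgroup is not a split Cartan subgroup -/

/-- **A non-split Cartan subgroup of `GL₂(𝔽_p)` (`p ≠ 2`) is not a split Cartan subgroup.**
If `kˣ = P (* 0; 0 *) P⁻¹` for a subalgebra `k ⊆ M₂(𝔽_p)` which is a field, then
`m = P diag(1, u) P⁻¹ - 1 ∈ k` (`u ≠ 1`) is non-zero of determinant `det diag(0, u - 1) = 0`,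
contradicting that non-zero elements of the field `k` are invertible (Serre 1972, §2.1: the two
kinds of Cartan subgroups, of orders `(p-1)²` and `p² - 1`). [cite: Serre1972, §2.1] -/
theorem unitGroup_ne_splitCartan {p : ℕ} [Fact p.Prime] (hp2 : p ≠ 2)
    {k : Subalgebra (ZMod p) (Matrix (Fin 2) (Fin 2) (ZMod p))} (hk : IsField k)
    (P : GL (Fin 2) (ZMod p)) : unitGroup k ≠ splitCartan P := by
  intro heq
  obtain ⟨u, hu⟩ := exists_units_ne_one hp2
  set g : GL (Fin 2) (ZMod p) := (MulAut.conj P).toMonoidHom (halfDiagonalHom u) with hg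
  have hgC : g ∈ splitCartan P := halfSplitCartan_le_splitCartan P
    ⟨halfDiagonalHom u, by rw [← range_halfDiagonalHom]; exact ⟨u, rfl⟩, rfl⟩
  rw [← heq, mem_unitGroup_iff] at hgC
  -- `m = g - 1 ∈ k`, non-zero
  have hm : (g : Matrix (Fin 2) (Fin 2) (ZMod p)) - 1 ∈ k := k.sub_mem hgC k.one_mem
  have hm0 : (g : Matrix (Fin 2) (Fin 2) (ZMod p)) - 1 ≠ 0 := by
    intro h0
    apply hu
    have h1 : g = 1 := Units.ext (sub_eq_zero.mp h0)
    have h2 : halfDiagonalHom u = 1 :=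
      (MulAut.conj P).injective (by rw [map_one]; exact h1)
    exact halfDiagonalHom_injective (h2.trans (map_one halfDiagonalHom).symm)
  -- but `det m = 0`
  refine det_ne_zero_of_isField hk hm hm0 ?_
  have hPu : IsUnit (P : Matrix (Fin 2) (Fin 2) (ZMod p)).det := (GL2.det_ne_zero P).isUnit
  have hgmat : (g : Matrix (Fin 2) (Fin 2) (ZMod p)) =
      (P : Matrix (Fin 2) (Fin 2) (ZMod p)) * diagonal ![(1 : ZMod p), (u : ZMod p)] *
        (P : Matrix (Fin 2) (Fin 2) (ZMod p))⁻¹ := by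
    rw [hg, MulEquiv.coe_toMonoidHom, MulAut.conj_apply, Units.val_mul, Units.val_mul,
      Matrix.coe_units_inv, coe_halfDiagonalHom]
  have hsub : (g : Matrix (Fin 2) (Fin 2) (ZMod p)) - 1 =
      (P : Matrix (Fin 2) (Fin 2) (ZMod p)) * (diagonal ![(1 : ZMod p), (u : ZMod p)] - 1) *
        (P : Matrix (Fin 2) (Fin 2) (ZMod p))⁻¹ := by
    rw [hgmat, Matrix.mul_sub, Matrix.sub_mul, Matrix.mul_one, Matrix.mul_nonsing_inv _ hPu]
  have hdiag : (diagonal ![(1 : ZMod p), (u : ZMod p)] - 1).det = 0 := by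
    rw [Matrix.det_fin_two]
    simp
  rw [hsub, Matrix.det_mul, Matrix.det_mul, hdiag, mul_zero, zero_mul]

/-! ### The image at a good ordinary prime contains a split half-Cartan subgroup -/

variable (W : WeierstrassCurve ℚ) [W.IsElliptic] [W.IsGloballyMinimal] (p : ℕ) [Fact p.Prime]
  (Φ : Multiplicative (AddAut (geomTorsion W p)) ≃* GL (Fin 2) (ZMod p))
  (e : geomTorsion W p ≃+ (Fin 2 → ZMod p))
  (he : ∀ (g : Multiplicative (AddAut (geomTorsion W p))) (x : geomTorsion W p),
    e (Multiplicative.toAdd g x) =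
      ((Φ g : GL (Fin 2) (ZMod p)) : Matrix (Fin 2) (Fin 2) (ZMod p)) *ᵥ e x)

include he

/-- **At a prime `p` of good ORDINARY reduction (`p ∤ N`, `p ∤ a_p`) the image
`G_p = Φ(ρ̄_{E,p}(Γ_ℚ)) ⊆ GL₂(𝔽_p)` of an elliptic curve `E = W/ℚ` (global minimal model)
contains a split half-Cartan subgroup `P (1 0; 0 *) P⁻¹` (second basis vector `P e₁ = e v₀`,
`𝔽_p v₀ = X_p` the kernel of reduction).**  Serre 1972, §1.11, Prop. 11 and Cor.: the inertia
group `I_𝔏` at a prime `𝔏 ∣ p` of `\bar ℤ` acts on `E[p]` trivially modulo the line `X_p` and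
through `χ̄_p`, onto `𝔽_pˣ`, on `X_p`; hence `Φ(ρ̄(I_𝔏))` contains a split half-Cartan subgroup
(Cor. (b)–(c)).  Tree inputs: `exists_line_of_not_dvd_frobeniusTrace_of_mem_primesAbove`
(the line), `exists_mem_inertia_smul_eq_of_sub_mem_line` (`χ_X = χ̄_p` onto, Weil pairing +
`ℚ(ζ_p)/ℚ` totally ramified), `Serre1972.exists_halfSplitCartan_le_map` (frame transport).
[cite: Serre1972, §1.11, Prop. 11 and Cor.] -/
theorem exists_halfSplitCartan_le_image_of_goodOrd (hord : GoodOrd W p) :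
    ∃ P : GL (Fin 2) (ZMod p),
      halfSplitCartan P ≤ (galoisRepTorsion W p).range.map Φ.toMonoidHom := by
  letI : Module (ZMod p) (geomTorsion W p) := AddSubgroup.torsionBy.zmodModule
  have hpP : p.Prime := Fact.out
  obtain ⟨v, hv⟩ : ∃ v : HeightOneSpectrum (𝓞 ℚ), (Rat.HeightOneSpectrum.primesEquiv v : ℕ) = p :=
    ⟨Rat.HeightOneSpectrum.primesEquiv.symm ⟨p, hpP⟩, by rw [Equiv.apply_symm_apply]⟩
  obtain ⟨𝔏, h𝔏⟩ := v.primesAbove_nonempty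
  have hΔ := W.not_dvd_minimalDiscriminantInt_of_hasGoodReductionAtPrime' p hord.1
  obtain ⟨v₀, hv₀, hquot⟩ :=
    exists_line_of_not_dvd_frobeniusTrace_of_mem_primesAbove p hΔ hord.2 hv h𝔏
  set ρ := galoisRepTorsion W p with hρ
  obtain ⟨P, -, hP⟩ := exists_halfSplitCartan_le_map e Φ he
    (I := (𝔏.inertia (absoluteGaloisGroup ℚ)).map ρ) hv₀
    (fun τ' ⟨τ, hτ, hτ'⟩ x ↦ by subst hτ'; exact hquot τ hτ x)
    (fun a ↦ by
      obtain ⟨τ, hτ, hτv⟩ := W.exists_mem_inertia_smul_eq_of_sub_mem_line p hv h𝔏 hv₀ hquot a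
      exact ⟨ρ τ, ⟨τ, hτ, rfl⟩, hτv⟩)
  exact ⟨P, hP.trans (Subgroup.map_mono fun x ⟨τ, _, hτ⟩ ↦ ⟨τ, hτ⟩)⟩

/-! ### No non-split Cartan normaliser at a good ordinary `p ≥ 5` -/

/-- **At a prime `p ≥ 5` of good ordinary reduction, the mod-`p` image of an elliptic curve over
`ℚ` is not contained in the normaliser of any non-split Cartan subgroup** (image type `pNn` in
Sutherland's notation is impossible).  Proof: `G_p` contains a split half-Cartan subgroup
`C' = P (1 0; 0 *) P⁻¹` (`exists_halfSplitCartan_le_image_of_goodOrd`); if `G_p ⊆ N(kˣ)` then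
`C' ⊆ N(kˣ)` and Serre's Prop. 14 (`p ≥ 5`: an element `P diag(1,u) P⁻¹`, `u² ≠ 1`, of `N - C`
would have scalar square) gives `kˣ = P (* 0; 0 *) P⁻¹`, a split Cartan subgroup — absurd
(`unitGroup_ne_splitCartan`).  No hypothesis on the image (irreducible or not, onto or not) and
none on CM. [cite: Serre1972, §2.2, Prop. 14; §1.11, Cor. to Prop. 11] -/
theorem not_le_normalizer_unitGroup_of_goodOrd (h5 : 5 ≤ p) (hord : GoodOrd W p)
    {k : Subalgebra (ZMod p) (Matrix (Fin 2) (Fin 2) (ZMod p))} (hk : IsField k)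
    (h2 : Module.finrank (ZMod p) k = 2) :
    ¬ (galoisRepTorsion W p).range.map Φ.toMonoidHom ≤
        Subgroup.normalizer (unitGroup k : Set (GL (Fin 2) (ZMod p))) := by
  intro hle
  obtain ⟨P, hP⟩ := exists_halfSplitCartan_le_image_of_goodOrd W p Φ e he hord
  have heq : unitGroup k = splitCartan P :=
    eq_splitCartan_of_halfSplitCartan_le_normalizer (unitGroup_mem_cartanSubgroups hk h2) h5
      (hP.trans hle)
  exact unitGroup_ne_splitCartan (p := p) (by omega) hk P heq

/-! ### `p ≥ 7`: a split Cartan normaliser of index two -/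

/-- **At a prime `p ≥ 7` of good ordinary reduction with `E[p]` irreducible and `ρ̄_{E,p}` not
onto, the image `G_p` normalises the SPLIT Cartan subgroup `C = P (* 0; 0 *) P⁻¹` of the inertia
half-Cartan `P (1 0; 0 *) P⁻¹ ⊆ G_p`, and `G_p ⊄ C`.**  Serre 1972, §4.2 b) over `ℚ` (tree
`exists_cartan_normalizer_of_not_hasSurjectiveModNGaloisRep`, i.e. Prop. 17 for `p ≠ 2, 5` with
§5.2 (iii)–(iv): `G_p` normalises some Cartan subgroup `C`, Borel and `GL₂` being excluded by
irreducibility and non-surjectivity), then Prop. 14 identifies `C`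
(`Serre1972.eq_splitCartan_of_halfSplitCartan_le_normalizer`).  So at such `p` the projective
image is dihedral of SPLIT type; the exceptional types `𝔄₄, 𝔖₄, 𝔄₅` and the non-split type do
not occur (for `p = 5` Prop. 17 does not apply to a half-Cartan of order `4`, and the type `5S4`
does occur). [cite: Serre1972, §4.2 b); §2.7 Prop. 17; §2.2 Prop. 14] -/
theorem exists_splitCartan_normalizer_of_goodOrd (h7 : 7 ≤ p) (hord : GoodOrd W p)
    (hirr : Irr W p) (hns : ¬ Surj W p) :
    ∃ P : GL (Fin 2) (ZMod p),
      halfSplitCartan P ≤ (galoisRepTorsion W p).range.map Φ.toMonoidHom ∧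
      (galoisRepTorsion W p).range.map Φ.toMonoidHom ≤
          Subgroup.normalizer (splitCartan P : Set (GL (Fin 2) (ZMod p))) ∧
        ¬ (galoisRepTorsion W p).range.map Φ.toMonoidHom ≤ splitCartan P := by
  have hp2 : p ≠ 2 := by omega
  have hp5 : p ≠ 5 := by omega
  have h5 : 5 ≤ p := by omega
  obtain ⟨P, hP⟩ := exists_halfSplitCartan_le_image_of_goodOrd W p Φ e he hord
  obtain ⟨C, hC, hGN, hGC⟩ := W.exists_cartan_normalizer_of_not_hasSurjectiveModNGaloisRep p Φ e
    he hp2 hp5 (Or.inl ⟨P, hP⟩) hirr hns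
  have hCP : C = splitCartan P :=
    eq_splitCartan_of_halfSplitCartan_le_normalizer hC h5 (hP.trans hGN)
  subst hCP
  exact ⟨P, hP, hGN, hGC⟩

/-- **The quadratic character of an exceptional good ordinary prime `p ≥ 7`.**  Under the
hypotheses of `exists_splitCartan_normalizer_of_goodOrd`, let `C` be the split Cartan subgroup
normalised by `G_p` and `U = ρ̄⁻¹(Φ⁻¹(C)) ≤ Γ_ℚ` ("`Gal(ℚ̄/K'_p)`", Serre §4.2 c)).  Then `U` is
open of index `2` — `ρ̄_{E,p}` is induced from the quadratic field `M` of `U` — and `U` contains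
the inertia group of every prime of `\bar ℤ` above `p` (Serre's Lemme 2 at `v ∣ p`: the image of
inertia, of order prime to `p` by Prop. 15, IS a split half-Cartan subgroup, which lies in `C` by
Prop. 14 — so `M` is UNRAMIFIED at `p`) and above every prime `q ≠ p` of good reduction (`E[p]`
is unramified there).  Tree inputs: `index_comap_cartan_eq_two`, `isOpen_comap_cartan`,
`inertia_le_comap_cartan`, `Serre1972.eq_halfSplitCartan_map_of_not_dvd_card`,
`Serre1972.prop14_halfSplitCartan`. [cite: Serre1972, §4.2 c), Lemme 2; §2.2 Prop. 14] -/
theorem exists_index_two_subgroup_of_goodOrd (h7 : 7 ≤ p) (hord : GoodOrd W p)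
    (hirr : Irr W p) (hns : ¬ Surj W p) :
    ∃ (P : GL (Fin 2) (ZMod p)),
      (galoisRepTorsion W p).range.map Φ.toMonoidHom ≤
          Subgroup.normalizer (splitCartan P : Set (GL (Fin 2) (ZMod p))) ∧
      ¬ (galoisRepTorsion W p).range.map Φ.toMonoidHom ≤ splitCartan P ∧
      IsOpen ((((splitCartan P).comap Φ.toMonoidHom).comap (galoisRepTorsion W p) :
          Subgroup (absoluteGaloisGroup ℚ)) : Set (absoluteGaloisGroup ℚ)) ∧
      (((splitCartan P).comap Φ.toMonoidHom).comap (galoisRepTorsion W p)).index = 2 ∧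
      (∀ (q : ℕ) [Fact q.Prime], W.HasGoodReductionAtPrime q →
        ∀ v : HeightOneSpectrum (𝓞 ℚ), (Rat.HeightOneSpectrum.primesEquiv v : ℕ) = q →
        ∀ 𝔔 ∈ v.primesAbove,
          𝔔.inertia (absoluteGaloisGroup ℚ) ≤
            ((splitCartan P).comap Φ.toMonoidHom).comap (galoisRepTorsion W p)) := by
  letI : Module (ZMod p) (geomTorsion W p) := AddSubgroup.torsionBy.zmodModule
  have hpP : p.Prime := Fact.out
  have hp2 : p ≠ 2 := by omega
  have h5 : 5 ≤ p := by omega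
  obtain ⟨P, hP, hGN, hGC⟩ := exists_splitCartan_normalizer_of_goodOrd W p Φ e he h7 hord hirr hns
  set ρ := galoisRepTorsion W p with hρ
  set G : Subgroup (GL (Fin 2) (ZMod p)) := ρ.range.map Φ.toMonoidHom with hG
  have hC : splitCartan P ∈ cartanSubgroups (ZMod p) := splitCartan_mem_cartanSubgroups P
  have hCp : (∃ P' : GL (Fin 2) (ZMod p), splitCartan P = splitCartan P') → p ≠ 2 := fun _ ↦ hp2
  refine ⟨P, hGN, hGC, isOpen_comap_cartan W p Φ, index_comap_cartan_eq_two W p Φ hC hCp hGN hGC,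
    ?_⟩
  intro q _ hgood v hv 𝔔 h𝔔
  by_cases hqp : q = p
  · -- at `p`: the image of inertia is a split half-Cartan subgroup inside `N(C)`, hence in `C`
    subst hqp
    -- `p ∤ #G` (Prop. 15: otherwise `G` is Borel or all of `GL₂`)
    have hpG : ¬ q ∣ Nat.card G := by
      intro hdvd
      rcases eq_top_or_borel_of_dvd_card G hdvd (exists_mem_map_range_det_eq W q Φ e he) with
        h | ⟨w, hw, hB⟩
      · exact hns ((map_range_galoisRepTorsion_eq_top_iff W q Φ).mp h)
      · exact not_le_eigenvectorStabilizer_of_hasIrreducibleModPGaloisRep W q Φ e he hirr hw hB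
    have hHle : ((𝔔.inertia (absoluteGaloisGroup ℚ)).map ρ).map Φ.toMonoidHom ≤ G :=
      Subgroup.map_mono (fun x ⟨τ, _, hτ⟩ ↦ ⟨τ, hτ⟩)
    have hpH : ¬ q ∣ Nat.card (((𝔔.inertia (absoluteGaloisGroup ℚ)).map ρ).map Φ.toMonoidHom) :=
      fun h ↦ hpG (h.trans (Subgroup.card_dvd_of_le hHle))
    have hΔ := W.not_dvd_minimalDiscriminantInt_of_hasGoodReductionAtPrime' q hord.1
    obtain ⟨v₀, hv₀, hquot⟩ :=
      exists_line_of_not_dvd_frobeniusTrace_of_mem_primesAbove q hΔ hord.2 hv h𝔔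
    obtain ⟨P', -, hP'⟩ := eq_halfSplitCartan_map_of_not_dvd_card e Φ he
      (I := (𝔔.inertia (absoluteGaloisGroup ℚ)).map ρ) hv₀
      (fun τ' ⟨τ, hτ, hτ'⟩ x ↦ by subst hτ'; exact hquot τ hτ x)
      (fun a ↦ by
        obtain ⟨τ, hτ, hτv⟩ := W.exists_mem_inertia_smul_eq_of_sub_mem_line q hv h𝔔 hv₀ hquot a
        exact ⟨ρ τ, ⟨τ, hτ, rfl⟩, hτv⟩) hpH
    have hHN : ((𝔔.inertia (absoluteGaloisGroup ℚ)).map ρ).map Φ.toMonoidHom ≤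
        Subgroup.normalizer (splitCartan P : Set (GL (Fin 2) (ZMod q))) := hHle.trans hGN
    have hHC : ((𝔔.inertia (absoluteGaloisGroup ℚ)).map ρ).map Φ.toMonoidHom ≤ splitCartan P := by
      rw [hP'] at hHN ⊢
      exact prop14_halfSplitCartan hC h5 hHN
    intro τ hτ
    rw [mem_comap_cartan_iff]
    exact hHC ⟨ρ τ, ⟨τ, hτ, rfl⟩, rfl⟩
  · exact inertia_le_comap_cartan W p Φ hqp hgood hv h𝔔

/-! ### Class X9 forms -/

/-- **X9 ⟹ the image is not in the normaliser of a non-split Cartan subgroup** (every `p`; class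
form of `not_le_normalizer_unitGroup_of_goodOrd`).  In Sutherland's labels: no X9 pair has image
of type `pNn`; the "residually dihedral" primes of X9 are split-dihedral. [folklore] -/
theorem ClassX9.not_le_normalizer_unitGroup (h : ClassX9 W p)
    {k : Subalgebra (ZMod p) (Matrix (Fin 2) (Fin 2) (ZMod p))} (hk : IsField k)
    (h2 : Module.finrank (ZMod p) k = 2) :
    ¬ (galoisRepTorsion W p).range.map Φ.toMonoidHom ≤
        Subgroup.normalizer (unitGroup k : Set (GL (Fin 2) (ZMod p))) :=
  not_le_normalizer_unitGroup_of_goodOrd W p Φ e he h.2.2.1 h.2.1 hk h2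

/-- **X9 at `p ≥ 7` ⟹ the image normalises the split Cartan subgroup of the inertia half-Cartan
and is not contained in it** (class form of `exists_splitCartan_normalizer_of_goodOrd`): the image
type is `pNs` (proper subgroups of `N(C_s)` meeting `N(C_s) - C_s` included); no exceptional
(`𝔖₄`-type) X9 pair exists at `p ≥ 7`. [folklore] -/
theorem ClassX9.exists_splitCartan_normalizer (h : ClassX9 W p) (h7 : 7 ≤ p) :
    ∃ P : GL (Fin 2) (ZMod p),
      halfSplitCartan P ≤ (galoisRepTorsion W p).range.map Φ.toMonoidHom ∧
      (galoisRepTorsion W p).range.map Φ.toMonoidHom ≤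
          Subgroup.normalizer (splitCartan P : Set (GL (Fin 2) (ZMod p))) ∧
        ¬ (galoisRepTorsion W p).range.map Φ.toMonoidHom ≤ splitCartan P :=
  exists_splitCartan_normalizer_of_goodOrd W p Φ e he h7 h.2.1 h.2.2.2.1 h.2.2.2.2.1

/-- **X9 at `p ≥ 7` ⟹ `ρ̄_{E,p}` is induced from a quadratic field `M` unramified at `p` and at
the good primes** (class form of `exists_index_two_subgroup_of_goodOrd`): `U = ρ̄⁻¹(C)` is open of
index `2` in `Γ_ℚ` and contains the inertia groups above `p` and above every good `q ≠ p`.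
[folklore] -/
theorem ClassX9.exists_index_two_subgroup (h : ClassX9 W p) (h7 : 7 ≤ p) :
    ∃ (P : GL (Fin 2) (ZMod p)),
      (galoisRepTorsion W p).range.map Φ.toMonoidHom ≤
          Subgroup.normalizer (splitCartan P : Set (GL (Fin 2) (ZMod p))) ∧
      ¬ (galoisRepTorsion W p).range.map Φ.toMonoidHom ≤ splitCartan P ∧
      IsOpen ((((splitCartan P).comap Φ.toMonoidHom).comap (galoisRepTorsion W p) :
          Subgroup (absoluteGaloisGroup ℚ)) : Set (absoluteGaloisGroup ℚ)) ∧
      (((splitCartan P).comap Φ.toMonoidHom).comap (galoisRepTorsion W p)).index = 2 ∧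
      (∀ (q : ℕ) [Fact q.Prime], W.HasGoodReductionAtPrime q →
        ∀ v : HeightOneSpectrum (𝓞 ℚ), (Rat.HeightOneSpectrum.primesEquiv v : ℕ) = q →
        ∀ 𝔔 ∈ v.primesAbove,
          𝔔.inertia (absoluteGaloisGroup ℚ) ≤
            ((splitCartan P).comap Φ.toMonoidHom).comap (galoisRepTorsion W p)) :=
  exists_index_two_subgroup_of_goodOrd W p Φ e he h7 h.2.1 h.2.2.2.1 h.2.2.2.2.1

end Literature.NumberTheory.EllipticCurves.Rank1Residual

/-! ### Appended: the population of X9 — `p ∈ {5, 7}` (given the published split-Cartan classification) -/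
namespace Literature.NumberTheory.EllipticCurves.Rank1Residual

/-- **Class X9 lives at `p ∈ {5, 7}` only.**  If `(E, p)` is an X9 pair (non-CM, `p ≥ 5` good
ordinary, `E[p]` irreducible, `ρ̄_{E,p}` not onto) then `p = 5` or `p = 7`.  Proof: for a prime
`p ≥ 11` (`6, 8, 9, 10` are not prime), `exists_splitCartan_normalizer_of_goodOrd` (Serre 1972,
§1.11 + Prop. 14 + Prop. 17, kernel) makes the image normalise a split Cartan subgroup, which for a
non-CM curve and `p > 7` contradicts Balakrishnan–Dogra–Müller–Tuitman–Vonk 2019, Thm. 1.2 (with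
Bilu–Parent–Rebolledo 2013, Cor. 1.2, for `p ≠ 13`) — the named fact `hBDMTV`
(`BalakrishnanEtAl2019.thm12_not_le_normalizer_splitCartan`, PUBLISHED, not proved here: the
theorem is conditional on it and on nothing else).  So X9 has no tail of large primes, and the
lane's collector filter is "image type `5Ns`/`5S4`/`7Ns` ∧ good ordinary ∧ `r_an ≤ 1`".
[cite: BalakrishnanEtAl2019, §1 Thm. 1.2 (arXiv:1711.05846 p. 2)] -/
theorem ClassX9.eq_five_or_eq_seven
    (hBDMTV : BalakrishnanEtAl2019.thm12_not_le_normalizer_splitCartan)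
    (W : WeierstrassCurve ℚ) [W.IsElliptic] [W.IsGloballyMinimal] (p : ℕ) [Fact p.Prime]
    (h : ClassX9 W p) : p = 5 ∨ p = 7 := by
  have hpP : p.Prime := Fact.out
  obtain ⟨hCM, hord, h5, hirr, hns, -⟩ := h
  by_contra hne
  push Not at hne
  have h7 : 7 < p := by
    rcases Nat.lt_or_ge 7 p with hlt | hle
    · exact hlt
    · exfalso
      interval_cases p
      · exact hne.1 rfl
      · exact absurd hpP (by decide)
      · exact hne.2 rfl
  obtain ⟨e, Φ, he, -⟩ := exists_frame_galoisRepTorsion_rat W p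
  obtain ⟨P, -, hGN, -⟩ :=
    exists_splitCartan_normalizer_of_goodOrd W p Φ e he (by omega) hord hirr hns
  exact hBDMTV W p hCM h7 Φ e he P hGN

/-- **The X9 dichotomy by prime** (given the same published fact): `p = 5`, or `p = 7` and the
image normalises the split Cartan subgroup of the inertia half-Cartan without lying in it (type
`7Ns`; `ρ̄_{E,7}` induced from a quadratic field unramified at `7`, `ClassX9.exists_index_two_subgroup`).
At `p = 5` Prop. 17 does not decide between `5Ns` and the exceptional `5S4` (both occur; `2268b1`
is `5S4`); neither normalises a non-split Cartan (`ClassX9.not_le_normalizer_unitGroup`).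
[cite: BalakrishnanEtAl2019, §1 Thm. 1.2 (arXiv:1711.05846 p. 2)] -/
theorem ClassX9.exists_splitCartan_normalizer_or_eq_five
    (hBDMTV : BalakrishnanEtAl2019.thm12_not_le_normalizer_splitCartan)
    (W : WeierstrassCurve ℚ) [W.IsElliptic] [W.IsGloballyMinimal] (p : ℕ) [Fact p.Prime]
    (Φ : Multiplicative (AddAut (geomTorsion W p)) ≃* GL (Fin 2) (ZMod p))
    (e : geomTorsion W p ≃+ (Fin 2 → ZMod p))
    (he : ∀ (g : Multiplicative (AddAut (geomTorsion W p))) (x : geomTorsion W p),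
      e (Multiplicative.toAdd g x) =
        ((Φ g : GL (Fin 2) (ZMod p)) : Matrix (Fin 2) (Fin 2) (ZMod p)) *ᵥ e x)
    (h : ClassX9 W p) :
    p = 5 ∨ (p = 7 ∧ ∃ P : GL (Fin 2) (ZMod p),
      halfSplitCartan P ≤ (galoisRepTorsion W p).range.map Φ.toMonoidHom ∧
      (galoisRepTorsion W p).range.map Φ.toMonoidHom ≤
          Subgroup.normalizer (splitCartan P : Set (GL (Fin 2) (ZMod p))) ∧
        ¬ (galoisRepTorsion W p).range.map Φ.toMonoidHom ≤ splitCartan P) := by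
  rcases ClassX9.eq_five_or_eq_seven hBDMTV W p h with h5 | h7
  · exact Or.inl h5
  · exact Or.inr ⟨h7, ClassX9.exists_splitCartan_normalizer W p Φ e he h (by omega)⟩

end Literature.NumberTheory.EllipticCurves.Rank1Residual

end
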